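import Literature.Barriers.CriticalPhenomena.LongRangeTrivialityOnZ3InfraredBoundHolds
import Literature.Probability.LatticeModels.GHSTruncatedPair

/-!
# The torus two-point function of a long-range Ising ferromagnet converges to the free state
# when the magnetisation vanishes (the uniqueness input of Panis 2023, Proposition 3.7)

Sibling of `Literature/Barriers/CriticalPhenomena/LongRangeTrivialityOnZ3.lean` (barrier catalogue
D-0021, sub-problem `Ising3DConformalLimit`), part of the discharge of the named fact
`Literature.Barriers.CriticalPhenomena.panis_prop37_infraredBound_fss` (Panis, arXiv:2309.05797 =
Ann. Probab. 54 (2026), Proposition 3.7: the infrared bound `Ŝ_β(p) ≤ 1/(β|J|(1-Ĵ(p)))` in INFINITE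
volume below `β_c`). The printed proof starts: "If `β < β_c(ρ)`, it is classical that there is only one
infinite volume equilibrium state … Moreover, for all `x`, `⟨τ₀τ_x⟩_{𝕋_L,ρ,β} → ⟨τ₀τ_x⟩_{ρ,β}`."
This file PROVES that convergence for every ferromagnetic, symmetric, translation-invariant pair
interaction `J` on `ℤ^d` with summable rows, at every `β > 0` with `m*(β) = 0` (so for
`0 < β < β_c`, `magnetization_eq_zero_of_lt_criticalBeta`), WITHOUT the DLR formalism and without
uniqueness as such — entirely by finite-volume correlation inequalities:

* `torusExpect_spinProduct_le_finCorr` — FREEZING (GKS, Friedli–Velenik Exercise 3.12): the torus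
  state `⟨σ_{Ā}⟩_{𝕋_N,c,β}` is at most the state of the box `Λ_R` with couplings `c∘proj` and the
  one-body fields `∑_{b∉proj Λ_R}c_{proj x,b}` of the frozen spins (`extendPlus`, `torusWeight_extendPlus`:
  the torus weight of a configuration frozen to `+1` off `proj Λ_R` is the box weight up to a constant);
  for `c = J^{(N)}` these couplings are the periodisation `periodicCoupling J N x y = ∑_z J_{x,y+Nz}`
  (`torusCoupling_proj_proj`) and the fields are at most the plus fields
  `plusField J Λ x = ∑_{w∉Λ}J_{x,w}` (`torusExpect_le_plusBox_periodic`, Griffiths' comparison);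
* `tendsto_gksExpect_periodic` — `J^{(N)}_{x,y} → J_{x,y}` (the periodisation error is a tail of `J`,
  `periodicCoupling_sub_le_tail`) and finite-volume states are continuous in the couplings
  (`continuous_gksExpect`), so the plus-type box states with the periodised couplings converge to the
  plus-type box state `⟨·⟩_{Λ;J,h⁺_Λ,β}` of `J`;
* `plusBox_pair_le` — GHS (Lebowitz 1974, the truncated pair function decreases in nonnegative fields,
  the tree's `gksTrunc_affCpl_one_le`): `⟨σ_aσ_{a+z}⟩_{Λ;J,h⁺,β} ≤ S_β(z) + ⟨σ_a⟩_{Λ;J,h⁺,β}`;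
* `sum_plusOnePoint_le` — the PRESSURE ARGUMENT (Friedli–Velenik Prop. 3.29, Remark 3.30, Thm. 3.34:
  `m* = m⁺(β,0)` through the one-sided derivatives of the pressure, here in finite volume): by Jensen
  twice on `log Z` along a uniform field `δ` and the comparison `|log Z⁺ - log Z^∅| ≤ βD_Λ`,
  `D_Λ = ∑_{x∈Λ}h⁺_Λ(x)`, one gets `∑_{x∈Λ}⟨σ_x⟩_{Λ;J,h⁺,β} ≤ |Λ| m^f(δ) + 2D_Λ/δ`, and `D_Λ = o(|Λ|)`
  (`sum_box_plusField_le_eventually`, the coupling defect of `…TorusZeroMode`), `m^f(δ) → m*(β) = 0`;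
* **`abs_torusPair_sub_pairCorrelation_le`** — averaging the GHS bound over the translates `a ∈ Λ_R`
  (torus translation invariance) and Griffiths' comparison free box `≤` torus for the lower bound:
  `|⟨σ₀σ_{z̄}⟩_{𝕋_M,J^{(M)},β} - S_β(z)| ≤ ε` for all large `M`.

Everything is PROVED; no named fact is introduced. The Fourier-side argument completing Proposition
3.7 is in `LongRangeTrivialityOnZ3InfraredBoundLowDimProofs.lean`.

## References

* R. Panis, arXiv:2309.05797 (2023) = Ann. Probab. 54 (2026), §3.1 (`J^{(L)}`), proof of
  Proposition 3.7 (first display: convergence of the torus two-point function) [Panis2023Triviality]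
  (held as TeX-derived text, pp. 13–15 read).
* S. Friedli, Y. Velenik, *Statistical Mechanics of Lattice Systems*, CUP (2017), §3.7: Prop. 3.29,
  Remark 3.30, Thm. 3.34, §3.7.2 ("when `h = 0`, uniqueness is equivalent to `m*(β) = 0`"); §3.8.1
  (GKS), Exercises 3.12, 3.31 [FriedliVelenik2017] (held; PDF pp. 112, 118–121, 141–142 read).
* J. L. Lebowitz, Comm. Math. Phys. 35 (1974) 87–92, eq. (1.8), §2 Remark (ii) (GHS) [Lebowitz1974]
  (through the tree's `GHSTruncatedPair`).
-/

noncomputable section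

namespace Literature.Barriers.CriticalPhenomena

open Literature.Probability.LatticeModels Literature.Probability.Percolation Filter Topology Finset
open scoped symmDiff

namespace LongRangeIsing

variable {d : ℕ}

section FinSystem

variable (Λ : Finset (Site d)) (c : Site d → Site d → ℝ) (β : ℝ) (hf : Site d → ℝ)

/-- The couplings of the finite-volume pair interaction `c` on `Λ` at inverse temperature `β` in the
site-dependent field `hf`: `K_{(z,w)} = (β/2)c_{z,w}` on ordered pairs, `K_z = β·hf(z)` on sites. [cite: FriedliVelenik2017, §3.8.1, p. 141] -/
def finCoupling : (↥Λ × ↥Λ) ⊕ ↥Λ → ℝ :=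
  Sum.elim (fun p : ↥Λ × ↥Λ => β / 2 * c p.1 p.2) fun z => β * hf z

/-- The supports: `{z} ∆ {w}` for the pair `(z,w)`, `{z}` for the site `z`. [cite: FriedliVelenik2017, §3.8.1, p. 141] -/
def finSupp : (↥Λ × ↥Λ) ⊕ ↥Λ → Finset ↥Λ :=
  Sum.elim (fun p : ↥Λ × ↥Λ => {p.1} ∆ {p.2}) fun z => {z}

/-- The finite-volume correlation `⟨σ_A⟩_{Λ;c,hf,β}` of the pair interaction `c` in the field `hf`. [cite: FriedliVelenik2017, §3.8.1, p. 141] -/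
def finCorr (A : Finset (Site d)) : ℝ :=
  gksExpect (univ : Finset ((↥Λ × ↥Λ) ⊕ ↥Λ)) (finCoupling Λ c β hf) (finSupp Λ) (spinProduct (inVol Λ A))

/-- The pair couplings are `(β/2)c`. [folklore] -/
@[simp] theorem finCoupling_inl (p : ↥Λ × ↥Λ) : finCoupling Λ c β hf (Sum.inl p) = β / 2 * c p.1 p.2 := rfl
/-- The site couplings are `β·hf`. [folklore] -/
@[simp] theorem finCoupling_inr (z : ↥Λ) : finCoupling Λ c β hf (Sum.inr z) = β * hf z := rfl
/-- The support of a pair coupling. [folklore] -/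
@[simp] theorem finSupp_inl (p : ↥Λ × ↥Λ) : finSupp Λ (Sum.inl p) = {p.1} ∆ {p.2} := rfl
/-- The support of a site coupling. [folklore] -/
@[simp] theorem finSupp_inr (z : ↥Λ) : finSupp Λ (Sum.inr z) = ({z} : Finset ↥Λ) := rfl

/-- The free state with uniform field is the case `c = J`, `hf ≡ h`. [folklore] -/
theorem expectIn_spinProduct_eq_finCorr (J : Site d → Site d → ℝ) (h : ℝ) (A : Finset (Site d)) :
    expectIn J Λ β h (spinProduct A) = finCorr Λ J β (fun _ => h) A := by
  rw [expectIn_spinProduct_eq_gksExpect_field]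
  rfl

/-- Supports have at most two sites. [folklore] -/
theorem card_finSupp_le_two (i : (↥Λ × ↥Λ) ⊕ ↥Λ) : (finSupp Λ i).card ≤ 2 := by
  rcases i with p | z
  · simp only [finSupp_inl]
    calc ({p.1} ∆ {p.2} : Finset ↥Λ).card ≤ ({p.1} ∪ {p.2} : Finset ↥Λ).card :=
          Finset.card_le_card (symmDiff_subset_union (s := ({p.1} : Finset ↥Λ)) (t := {p.2}))
      _ ≤ ({p.1} : Finset ↥Λ).card + ({p.2} : Finset ↥Λ).card := Finset.card_union_le _ _
      _ = 2 := by simp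
  · simp

variable {Λ c β hf}

/-- Nonnegative couplings for `β ≥ 0`, `c ≥ 0`, `hf ≥ 0`. [folklore] -/
theorem finCoupling_nonneg (hβ : 0 ≤ β) (hc : ∀ x y, 0 ≤ c x y) (hhf : ∀ x, 0 ≤ hf x)
    (i : (↥Λ × ↥Λ) ⊕ ↥Λ) : 0 ≤ finCoupling Λ c β hf i := by
  rcases i with p | z
  · exact mul_nonneg (by positivity) (hc _ _)
  · exact mul_nonneg hβ (hhf _)

/-- GKS I. [cite: FriedliVelenik2017, Thm. 3.49, eq. (3.54), p. 141] -/
theorem finCorr_nonneg (hβ : 0 ≤ β) (hc : ∀ x y, 0 ≤ c x y) (hhf : ∀ x, 0 ≤ hf x) (A : Finset (Site d)) :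
    0 ≤ finCorr Λ c β hf A :=
  gksExpect_spinProduct_nonneg _ _ _ (fun i _ => finCoupling_nonneg hβ hc hhf i) _

/-- `⟨σ_A⟩ ≤ 1`. [folklore] -/
theorem finCorr_le_one (A : Finset (Site d)) : finCorr Λ c β hf A ≤ 1 := by
  have h := abs_gksExpect_le (univ : Finset ((↥Λ × ↥Λ) ⊕ ↥Λ)) (finCoupling Λ c β hf) (finSupp Λ)
    (f := spinProduct (inVol Λ A)) (M := 1) (fun ω => abs_spinProduct_le_one _ _)
  exact (le_abs_self _).trans h

/-- Griffiths' comparison: `|c'| ≤ c` and `|hf'| ≤ hf` on `Λ` give `⟨σ_A⟩_{c',hf'} ≤ ⟨σ_A⟩_{c,hf}` (`β ≥ 0`). [cite: FriedliVelenik2017, Exercise 3.31, p. 142] -/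
theorem finCorr_mono (hβ : 0 ≤ β) {c' : Site d → Site d → ℝ} {hf' : Site d → ℝ}
    (hcc' : ∀ x ∈ Λ, ∀ y ∈ Λ, |c' x y| ≤ c x y) (hh' : ∀ x ∈ Λ, |hf' x| ≤ hf x) (A : Finset (Site d)) :
    finCorr Λ c' β hf' A ≤ finCorr Λ c β hf A := by
  refine gksExpect_mono_of_abs_le _ _ (fun i _ => ?_) _
  rcases i with p | z
  · simp only [finCoupling_inl]
    rw [abs_mul, abs_of_nonneg (by positivity : (0 : ℝ) ≤ β / 2)]
    exact mul_le_mul_of_nonneg_left (hcc' _ p.1.2 _ p.2.2) (by positivity)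
  · simp only [finCoupling_inr]
    rw [abs_mul, abs_of_nonneg hβ]
    exact mul_le_mul_of_nonneg_left (hh' _ z.2) hβ

end FinSystem

/-! ### GHS: the truncated pair function of the field-free system dominates -/

section GHS

variable {Λ : Finset (Site d)} {c : Site d → Site d → ℝ} {β : ℝ} {hf : Site d → ℝ}

/-- `⟨σ_xσ_y⟩_{hf} - ⟨σ_x⟩_{hf}⟨σ_y⟩_{hf} ≤ ⟨σ_xσ_y⟩_{0} - ⟨σ_x⟩_0⟨σ_y⟩_0` for `hf ≥ 0` (GHS integrated
along the fields). [cite: Lebowitz1974, eq. (1.8) and §2, Remark (ii)] -/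
theorem finTrunc_le_finTrunc_zero (hβ : 0 ≤ β) (hc : ∀ x y, 0 ≤ c x y) (hhf : ∀ x, 0 ≤ hf x) (x y : ↥Λ) :
    gksExpect univ (finCoupling Λ c β hf) (finSupp Λ) (fun σ => spinAt x σ * spinAt y σ) -
        gksExpect univ (finCoupling Λ c β hf) (finSupp Λ) (spinAt x) *
          gksExpect univ (finCoupling Λ c β hf) (finSupp Λ) (spinAt y) ≤
      gksExpect univ (finCoupling Λ c β (fun _ => 0)) (finSupp Λ) (fun σ => spinAt x σ * spinAt y σ) -
        gksExpect univ (finCoupling Λ c β (fun _ => 0)) (finSupp Λ) (spinAt x) *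
          gksExpect univ (finCoupling Λ c β (fun _ => 0)) (finSupp Λ) (spinAt y) := by
  set W : (↥Λ × ↥Λ) ⊕ ↥Λ → ℝ := Sum.elim (fun _ => 0) (fun z => β * hf z) with hW
  have hK : ∀ i ∈ (univ : Finset ((↥Λ × ↥Λ) ⊕ ↥Λ)), 0 ≤ finCoupling Λ c β (fun _ => 0) i :=
    fun i _ => finCoupling_nonneg hβ hc (fun _ => le_rfl) i
  have hW0 : ∀ i ∈ (univ : Finset ((↥Λ × ↥Λ) ⊕ ↥Λ)), 0 ≤ W i := by
    rintro (p | z) -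
    · simp [hW]
    · simpa [hW] using mul_nonneg hβ (hhf z)
  have hW1 : ∀ i ∈ (univ : Finset ((↥Λ × ↥Λ) ⊕ ↥Λ)), W i ≠ 0 → ∃ z, finSupp Λ i = {z} := by
    rintro (p | z) - h
    · simp [hW] at h
    · exact ⟨z, rfl⟩
  have haff : affCpl (finCoupling Λ c β (fun _ => 0)) W 1 = finCoupling Λ c β hf := by
    funext i
    rcases i with p | z
    · simp [affCpl, hW, finCoupling]
    · simp [affCpl, hW, finCoupling]
  have h := gksTrunc_affCpl_one_le univ (finCoupling Λ c β fun _ => 0) W (finSupp Λ) hK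
    (fun i _ => card_finSupp_le_two Λ i) hW0 hW1 x y
  rwa [haff] at h

/-- **GHS consequence**: `⟨σ_xσ_y⟩_{c,hf} ≤ ⟨σ_xσ_y⟩_{c,0} + ⟨σ_x⟩_{c,hf}⟨σ_y⟩_{c,hf}` for `hf ≥ 0`
(the one-point functions at zero field are nonnegative by GKS I). [cite: Lebowitz1974, eq. (1.8) and §2, Remark (ii)] -/
theorem finPair_le_finPair_zero_add (hβ : 0 ≤ β) (hc : ∀ x y, 0 ≤ c x y) (hhf : ∀ x, 0 ≤ hf x) (x y : ↥Λ) :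
    gksExpect univ (finCoupling Λ c β hf) (finSupp Λ) (fun σ => spinAt x σ * spinAt y σ) ≤
      gksExpect univ (finCoupling Λ c β (fun _ => 0)) (finSupp Λ) (fun σ => spinAt x σ * spinAt y σ) +
        gksExpect univ (finCoupling Λ c β hf) (finSupp Λ) (spinAt x) *
          gksExpect univ (finCoupling Λ c β hf) (finSupp Λ) (spinAt y) := by
  have h := finTrunc_le_finTrunc_zero hβ hc hhf x y
  have h0 : 0 ≤ gksExpect univ (finCoupling Λ c β (fun _ => 0)) (finSupp Λ) (spinAt x) *
      gksExpect univ (finCoupling Λ c β (fun _ => 0)) (finSupp Λ) (spinAt y) := by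
    rw [← spinProduct_singleton_eq_spinAt, ← spinProduct_singleton_eq_spinAt]
    exact mul_nonneg (gksExpect_spinProduct_nonneg _ _ _ (fun i _ => finCoupling_nonneg hβ hc (fun _ => le_rfl) i) _)
      (gksExpect_spinProduct_nonneg _ _ _ (fun i _ => finCoupling_nonneg hβ hc (fun _ => le_rfl) i) _)
  linarith

end GHS

/-! ### The pressure argument: plus-type one-point functions are controlled by free ones -/

section Pressure

variable {Λ : Finset (Site d)} {c : Site d → Site d → ℝ} {β : ℝ} {hf : Site d → ℝ}

/-- Shifting all fields by `t` is the affine path in the uniform direction. [folklore] -/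
theorem affCpl_finCoupling_uniform (t : ℝ) :
    affCpl (finCoupling Λ c β hf) (Sum.elim (fun _ : ↥Λ × ↥Λ => (0 : ℝ)) fun _ : ↥Λ => β) t =
      finCoupling Λ c β (fun x => hf x + t) := by
  funext i
  rcases i with p | z
  · simp [affCpl, finCoupling]
  · simp only [affCpl, finCoupling_inr, Sum.elim_inr]
    ring

/-- The mean energy in the uniform direction is `β ∑_z ⟨σ_z⟩`. [folklore] -/
theorem sum_uniform_mul_gksExpect (K : (↥Λ × ↥Λ) ⊕ ↥Λ → ℝ) :
    ∑ i ∈ (univ : Finset ((↥Λ × ↥Λ) ⊕ ↥Λ)),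
        (Sum.elim (fun _ : ↥Λ × ↥Λ => (0 : ℝ)) fun _ : ↥Λ => β) i *
          gksExpect univ K (finSupp Λ) (spinProduct (finSupp Λ i)) =
      β * ∑ z : ↥Λ, gksExpect univ K (finSupp Λ) (spinProduct {z}) := by
  rw [Fintype.sum_sum_type]
  simp [Finset.mul_sum]

/-- Comparing the plus-type and free partition functions: `|log Z_{hf+t} - log Z_{0+t}| ≤ β ∑_z |hf z|`. [cite: FriedliVelenik2017, §3.2.1, proof of Thm. 3.6 (boundary terms)] -/
theorem abs_log_finZ_sub_le (t : ℝ) :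
    |Real.log (gksSum univ (finCoupling Λ c β (fun x => hf x + t)) (finSupp Λ) (fun _ => 1)) -
        Real.log (gksSum univ (finCoupling Λ c β (fun _ => (0 : ℝ) + t)) (finSupp Λ) (fun _ => 1))| ≤
      |β| * ∑ z : ↥Λ, |hf z| := by
  refine (abs_log_gksSum_sub_log_gksSum_le univ (finCoupling Λ c β (fun x => hf x + t)) (finSupp Λ)
    (finCoupling Λ c β (fun _ => (0 : ℝ) + t))).trans (le_of_eq ?_)
  rw [Fintype.sum_sum_type, Finset.mul_sum]
  simp only [finCoupling_inl, sub_self, abs_zero, Finset.sum_const_zero, zero_add, finCoupling_inr]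
  refine Finset.sum_congr rfl fun z _ => ?_
  rw [← abs_mul]
  congr 1
  ring

/-- **The pressure bound**: for `β > 0`, `c ≥ 0`, `hf ≥ 0` and `δ > 0`,
`∑_{z∈Λ} ⟨σ_z⟩_{c,hf} ≤ ∑_{z∈Λ} ⟨σ_z⟩_{c,δ} + 2(∑_z hf z)/δ` (Jensen twice on `log Z` along the uniform
field, and the comparison of the two partition functions). [cite: FriedliVelenik2017, Prop. 3.29 and Thm. 3.34 (one-sided derivatives of the pressure are the ± magnetisations)] -/
theorem sum_finOnePoint_le (hβ : 0 < β) (hhf : ∀ x, 0 ≤ hf x) {δ : ℝ} (hδ : 0 < δ) :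
    ∑ z : ↥Λ, gksExpect univ (finCoupling Λ c β hf) (finSupp Λ) (spinProduct {z}) ≤
      ∑ z : ↥Λ, gksExpect univ (finCoupling Λ c β (fun _ => δ)) (finSupp Λ) (spinProduct {z}) +
        2 * (∑ z : ↥Λ, hf z) / δ := by
  set Wu : (↥Λ × ↥Λ) ⊕ ↥Λ → ℝ := Sum.elim (fun _ : ↥Λ × ↥Λ => (0 : ℝ)) fun _ : ↥Λ => β with hWu
  -- Jensen, lower bound, plus system between `0` and `δ`
  have h1 := (log_gksSum_affCpl_sub_mem univ (finCoupling Λ c β hf) Wu (finSupp Λ) hδ.le).1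
  rw [affCpl_zero, affCpl_finCoupling_uniform, sum_uniform_mul_gksExpect, sub_zero] at h1
  -- Jensen, upper bound, free system between `0` and `δ`
  have h2 := (log_gksSum_affCpl_sub_mem univ (finCoupling Λ c β (fun _ => (0 : ℝ))) Wu (finSupp Λ) hδ.le).2
  rw [affCpl_zero, affCpl_finCoupling_uniform, sum_uniform_mul_gksExpect, sub_zero] at h2
  -- comparison of the partition functions at `δ` and at `0`
  have h3 := abs_log_finZ_sub_le (Λ := Λ) (c := c) (β := β) (hf := hf) δ
  have h4 := abs_log_finZ_sub_le (Λ := Λ) (c := c) (β := β) (hf := hf) 0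
  simp only [add_zero] at h4
  rw [abs_of_pos hβ] at h3 h4
  have hD : ∑ z : ↥Λ, |hf z| = ∑ z : ↥Λ, hf z := Finset.sum_congr rfl fun z _ => abs_of_nonneg (hhf z)
  rw [hD] at h3 h4
  have e0 : (fun _ : Site d => (0 : ℝ) + δ) = fun _ => δ := by funext; ring
  rw [e0] at h3 h2
  set D : ℝ := ∑ z : ↥Λ, hf z with hDdef
  set P0 := Real.log (gksSum univ (finCoupling Λ c β hf) (finSupp Λ) fun _ => 1)
  set Pδ := Real.log (gksSum univ (finCoupling Λ c β (fun x => hf x + δ)) (finSupp Λ) fun _ => 1)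
  set F0 := Real.log (gksSum univ (finCoupling Λ c β (fun _ => (0 : ℝ))) (finSupp Λ) fun _ => 1)
  set Fδ := Real.log (gksSum univ (finCoupling Λ c β (fun _ => δ)) (finSupp Λ) fun _ => 1)
  set Mp := ∑ z : ↥Λ, gksExpect univ (finCoupling Λ c β hf) (finSupp Λ) (spinProduct {z})
  set Mf := ∑ z : ↥Λ, gksExpect univ (finCoupling Λ c β (fun _ => δ)) (finSupp Λ) (spinProduct {z})
  have h3' := (abs_le.1 h3)
  have h4' := abs_le.1 h4
  -- `δβ Mp ≤ Pδ - P0 ≤ (Fδ + βD) - (F0 - βD) ≤ δβ Mf + 2βD`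
  have key : δ * (β * Mp) ≤ δ * (β * Mf) + 2 * (β * D) := by linarith [h3'.1, h3'.2, h4'.1, h4'.2]
  have h5 : β * (δ * Mp) ≤ β * (δ * Mf + 2 * D) := by nlinarith [key]
  have h6 : δ * Mp ≤ δ * Mf + 2 * D := le_of_mul_le_mul_left h5 hβ
  rw [show Mf + 2 * D / δ = (δ * Mf + 2 * D) / δ by field_simp, le_div_iff₀ hδ]
  linarith

end Pressure


/-! ### The plus boundary field of a long-range interaction and the plus-type state of a box -/

section PlusField

variable (J : Site d → Site d → ℝ) (Λ : Finset (Site d))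

/-- The field exerted on `x` by all the spins OUTSIDE `Λ` frozen to `+1`:
`h⁺_Λ(x) = ∑_{w ∉ Λ} J_{x,w} = ∑_w J_{x,w} - ∑_{y ∈ Λ} J_{x,y}`. [cite: FriedliVelenik2017, §3.8.1, p. 141 (the + boundary condition as one-body couplings)] -/
def plusField (x : Site d) : ℝ := ∑' w, J x w - ∑ y ∈ Λ, J x y

variable {J Λ}

/-- `h⁺_Λ ≥ 0` for `J ≥ 0` translation invariant with summable rows. [folklore] -/
theorem plusField_nonneg (hJ : ∀ x y, 0 ≤ J x y) (hJt : ∀ a x y, J (x + a) (y + a) = J x y)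
    (hJs : Summable (J 0)) (x : Site d) : 0 ≤ plusField J Λ x := by
  rw [plusField, sub_nonneg]
  exact (summable_row J hJt hJs x).1.sum_le_tsum Λ fun y _ => hJ x y

/-- The total plus field of a box is the coupling defect of the cube of the same side:
`∑_{x∈Λ_R} h⁺_{Λ_R}(x) = D_{2R+1}`. [folklore] -/
theorem sum_box_plusField_eq_couplingDefect (hJt : ∀ a x y, J (x + a) (y + a) = J x y)
    (hJs : Summable (J 0)) (R : ℕ) :
    ∑ x ∈ box d R, plusField J (box d R) x = couplingDefect J (2 * R + 1) := by
  haveI : NeZero (2 * R + 1) := ⟨by omega⟩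
  rw [couplingDefect_eq J (2 * R + 1) hJt hJs]
  simp only [plusField, Finset.sum_sub_distrib]
  have hrow : ∀ x : Site d, ∑' w, J x w = ∑' w, J 0 w := fun x => (summable_row J hJt hJs x).2
  simp_rw [hrow]
  rw [Finset.sum_const, Finset.sum_const, card_box, card_halfOpenBox]
  congr 1
  -- the double sums agree by the translation `x ↦ x + R𝟙`
  set v : Site d := fun _ => (R : ℤ) with hv
  have hmap : (box d R).map (Equiv.addRight v).toEmbedding = halfOpenBox d (2 * R + 1) := by
    ext y
    rw [Finset.mem_map_equiv, mem_box, mem_halfOpenBox]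
    simp only [Equiv.addRight_symm, Equiv.coe_addRight, Pi.add_apply, Pi.neg_apply, hv]
    refine forall_congr' fun i => ?_
    push_cast
    constructor <;> rintro ⟨h1, h2⟩ <;> constructor <;> linarith
  rw [← hmap, Finset.sum_map]
  refine Finset.sum_congr rfl fun x _ => ?_
  rw [Finset.sum_map]
  refine Finset.sum_congr rfl fun y _ => ?_
  simp only [Equiv.coe_toEmbedding, Equiv.coe_addRight]
  rw [hJt]

/-- **The plus fields of large boxes are negligible on average**: for every `ε > 0`,
`∑_{x∈Λ_R} h⁺_{Λ_R}(x) ≤ ε |Λ_R|` for all large `R` (`J ≥ 0` translation invariant, summable rows). [folklore] -/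
theorem sum_box_plusField_le_eventually (hJ : ∀ x y, 0 ≤ J x y) (hJt : ∀ a x y, J (x + a) (y + a) = J x y)
    (hJs : Summable (J 0)) {ε : ℝ} (hε : 0 < ε) :
    ∃ R₀ : ℕ, ∀ R : ℕ, R₀ ≤ R → ∑ x ∈ box d R, plusField J (box d R) x ≤ ε * #(box d R) := by
  obtain ⟨N₀, hN₀⟩ := couplingDefect_le_eventually J hJ hJt hJs hε
  refine ⟨N₀, fun R hR => ?_⟩
  haveI : NeZero (2 * R + 1) := ⟨by omega⟩
  rw [sum_box_plusField_eq_couplingDefect hJt hJs R, card_box]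
  have h := hN₀ (2 * R + 1) (by omega)
  push_cast at h ⊢
  exact h

end PlusField

/-! ### The plus-type state of a box: average one-point functions below `β_c` -/

section PlusBox

variable {J : Site d → Site d → ℝ} {β : ℝ}

/-- The free one-point function of a box at field `δ ≥ 0` is at most `m^f(δ) = ⟨σ₀⟩_{J,δ,β}`. [cite: FriedliVelenik2017, Exercise 3.12, p. 112] -/
theorem finOnePoint_free_le_state (hβ : 0 ≤ β) {δ : ℝ} (hδ : 0 ≤ δ) (hJ : ∀ x y, 0 ≤ J x y)
    (hJt : ∀ a x y, J (x + a) (y + a) = J x y) {Λ : Finset (Site d)} (z : ↥Λ) :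
    gksExpect univ (finCoupling Λ J β (fun _ => δ)) (finSupp Λ) (spinProduct {z}) ≤ state J β δ (spinAt 0) := by
  have h1 : gksExpect univ (finCoupling Λ J β (fun _ => δ)) (finSupp Λ) (spinProduct {z}) =
      expectIn J Λ β δ (spinProduct {(z : Site d)}) := by
    have hin : inVol Λ ({(z : Site d)} : Finset (Site d)) = {z} := by
      ext w
      rw [mem_inVol, Finset.mem_singleton, Finset.mem_singleton]
      exact Subtype.ext_iff.symm
    rw [expectIn_spinProduct_eq_finCorr, finCorr, hin]
  rw [h1, ← state_spinAt_eq_state_spinAt_zero J β δ hβ hδ hJ hJt z, ← spinProduct_singleton_eq_spinAt]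
  exact expectIn_le_state_field J β δ hβ hδ hJ (Finset.singleton_subset_iff.2 z.2)

/-- **Average plus-type magnetisation of a box**: for `β > 0`, `δ > 0`, `J ≥ 0` translation invariant with
summable rows, `∑_{z∈Λ} ⟨σ_z⟩_{Λ;J,h⁺_Λ,β} ≤ |Λ| m^f(δ) + 2 D_Λ/δ`. [cite: FriedliVelenik2017, Remark 3.30 (m*(β) = m⁺(β,0)) with Prop. 3.29 and Thm. 3.34] -/
theorem sum_plusOnePoint_le (hβ : 0 < β) (hJ : ∀ x y, 0 ≤ J x y) (hJt : ∀ a x y, J (x + a) (y + a) = J x y)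
    (hJs : Summable (J 0)) (Λ : Finset (Site d)) {δ : ℝ} (hδ : 0 < δ) :
    ∑ z : ↥Λ, gksExpect univ (finCoupling Λ J β (plusField J Λ)) (finSupp Λ) (spinProduct {z}) ≤
      #Λ * state J β δ (spinAt 0) + 2 * (∑ x ∈ Λ, plusField J Λ x) / δ := by
  have h := sum_finOnePoint_le (Λ := Λ) (c := J) hβ (plusField_nonneg (Λ := Λ) hJ hJt hJs) hδ
  refine h.trans (add_le_add ?_ (le_of_eq ?_))
  · calc ∑ z : ↥Λ, gksExpect univ (finCoupling Λ J β (fun _ => δ)) (finSupp Λ) (spinProduct {z})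
        ≤ ∑ _z : ↥Λ, state J β δ (spinAt 0) :=
          Finset.sum_le_sum fun z _ => finOnePoint_free_le_state hβ.le hδ.le hJ hJt z
      _ = #Λ * state J β δ (spinAt 0) := by
          rw [Finset.sum_const, Finset.card_univ, Fintype.card_coe, nsmul_eq_mul]
  · rw [Finset.sum_coe_sort Λ (fun x => plusField J Λ x)]

end PlusBox

/-! ### The periodised coupling seen on `ℤ^d` and its convergence to `J` -/

section Periodic

variable (J : Site d → Site d → ℝ) (N : ℕ)

/-- `J^{(N)}_{x,y} := ∑_{z∈ℤ^d} J_{x,y+Nz}` as a coupling on `ℤ^d` (Panis's periodisation before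
passing to the quotient). [cite: Panis2023Triviality, §3.1 (J^{(L)}_{x,y} := ∑_{z∈ℤ^d} J_{x,y+Lz})] -/
def periodicCoupling (x y : Site d) : ℝ := ∑' z : Site d, J x (y + (N : ℤ) • z)

variable {J N}

/-- Translation invariance moves a lattice vector from the first to the second argument. [folklore] -/
theorem coupling_add_left (hJt : ∀ a x y, J (x + a) (y + a) = J x y) (x u w : Site d) :
    J (x + u) w = J x (w - u) := by
  rw [← hJt u x (w - u), sub_add_cancel]

/-- **The torus coupling at projected points is the periodised coupling**:
`J^{(N)}_{proj x, proj y} = ∑_z J_{x,y+Nz}`. [cite: Panis2023Triviality, §3.1 (J^{(L)} on 𝕋_L)] -/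
theorem torusCoupling_proj_proj (hJt : ∀ a x y, J (x + a) (y + a) = J x y) [NeZero N] (x y : Site d) :
    torusCoupling J N (Torus.proj N x) (Torus.proj N y) = periodicCoupling J N x y := by
  obtain ⟨u, hu⟩ := exists_torusLift_proj_eq N x
  obtain ⟨v, hv⟩ := exists_torusLift_proj_eq N y
  rw [torusCoupling, periodicCoupling, hu, hv]
  have key : ∀ z : Site d, J (x + (N : ℤ) • u) (y + (N : ℤ) • v + (N : ℤ) • z) =
      J x (y + (N : ℤ) • (z + (v - u))) := by
    intro z
    rw [coupling_add_left hJt]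
    congr 1
    simp only [smul_add, smul_sub]
    abel
  simp_rw [key]
  exact (Equiv.addRight (v - u)).tsum_eq fun z => J x (y + (N : ℤ) • z)

/-- `J^{(N)} ≥ 0` on `ℤ^d`. [folklore] -/
theorem periodicCoupling_nonneg (hJ : ∀ x y, 0 ≤ J x y) (x y : Site d) : 0 ≤ periodicCoupling J N x y :=
  tsum_nonneg fun _ => hJ _ _

/-- `J ≤ J^{(N)}` (the term `z = 0`). [folklore] -/
theorem le_periodicCoupling (hJ : ∀ x y, 0 ≤ J x y) (hJt : ∀ a x y, J (x + a) (y + a) = J x y)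
    (hJs : Summable (J 0)) [NeZero N] (x y : Site d) : J x y ≤ periodicCoupling J N x y := by
  have hs := summable_coupling_add_smul J N hJt hJs x y
  have h := hs.le_tsum (0 : Site d) fun z _ => hJ _ _
  simpa [periodicCoupling] using h

/-- `J^{(N)}` is symmetric when `J` is symmetric and translation invariant. [folklore] -/
theorem periodicCoupling_symm (hJt : ∀ a x y, J (x + a) (y + a) = J x y) (hJsym : ∀ x y, J x y = J y x)
    (x y : Site d) : periodicCoupling J N x y = periodicCoupling J N y x := by
  rw [periodicCoupling, periodicCoupling]
  have key : ∀ z : Site d, J x (y + (N : ℤ) • z) = J y (x + (N : ℤ) • (-z)) := by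
    intro z
    rw [hJsym, coupling_add_left hJt, smul_neg, sub_eq_add_neg]
  simp_rw [key]
  exact (Equiv.neg (Site d)).tsum_eq fun z => J y (x + (N : ℤ) • z)

/-- The periodisation error is a tail of `J`: for `K + ‖y - x‖_∞ < N`,
`0 ≤ J^{(N)}_{x,y} - J_{x,y} ≤ ∑_{u ∉ Λ_K} J_{0,u}`. [folklore] -/
theorem periodicCoupling_sub_le_tail (hJ : ∀ x y, 0 ≤ J x y) (hJt : ∀ a x y, J (x + a) (y + a) = J x y)
    (hJs : Summable (J 0)) [NeZero N] {K : ℕ} {x y : Site d} (hK : K + Site.supNorm (y - x) < N) :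
    periodicCoupling J N x y - J x y ≤ ∑' u : {u // u ∉ box d K}, J 0 u := by
  have hs := summable_coupling_add_smul J N hJt hJs x y
  have hsplit := hs.sum_add_tsum_compl (s := ({0} : Finset (Site d)))
  rw [Finset.sum_singleton, smul_zero, add_zero] at hsplit
  rw [periodicCoupling, ← hsplit, add_sub_cancel_left]
  -- compare along the injection `z ↦ (y - x) + Nz` into the complement of `Λ_K`
  have hmem : ∀ z : Site d, z ≠ 0 → y - x + (N : ℤ) • z ∉ box d K := by
    intro z hz hzb
    obtain ⟨i, hi⟩ : ∃ i, z i ≠ 0 := by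
      by_contra hall
      push Not at hall
      exact hz (funext hall)
    rw [mem_box] at hzb
    have hb := hzb i
    simp only [Pi.add_apply, Pi.sub_apply, Pi.smul_apply, smul_eq_mul] at hb
    have hyx : |(y - x) i| ≤ Site.supNorm (y - x) := by
      have := Finset.le_sup (f := fun j => ((y - x) j).natAbs) (Finset.mem_univ i)
      rw [Site.supNorm]
      have h' : (((y - x) i).natAbs : ℤ) ≤ ((univ.sup fun j => ((y - x) j).natAbs : ℕ) : ℤ) := by exact_mod_cast this
      rwa [Int.natCast_natAbs] at h'
    simp only [Pi.sub_apply] at hyx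
    have hN1 : (1 : ℤ) ≤ |z i| := Int.one_le_abs hi
    have hNz : (N : ℤ) ≤ |(N : ℤ) * z i| := by
      rw [abs_mul, Nat.abs_cast]
      nlinarith
    have hKlt : ((K : ℕ) : ℤ) + (Site.supNorm (y - x) : ℤ) < N := by exact_mod_cast hK
    rcases abs_cases ((N : ℤ) * z i) with ⟨h1, _⟩ | ⟨h1, _⟩ <;>
      rcases abs_cases (y i - x i) with ⟨h2, _⟩ | ⟨h2, _⟩ <;> omega
  set ι : {z : Site d // z ∈ ((↑({0} : Finset (Site d)) : Set (Site d))ᶜ)} → {u : Site d // u ∉ box d K} :=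
    fun z => ⟨y - x + (N : ℤ) • (z : Site d), hmem z (by
      have hz := z.2
      simpa using hz)⟩ with hι
  have hinj : Function.Injective ι := by
    intro z w h
    have h' : y - x + (N : ℤ) • (z : Site d) = y - x + (N : ℤ) • (w : Site d) := congrArg Subtype.val h
    exact Subtype.ext (add_smul_injective N (y - x) h')
  have hterm : ∀ z : {z : Site d // z ∈ ((↑({0} : Finset (Site d)) : Set (Site d))ᶜ)},
      J x (y + (N : ℤ) • (z : Site d)) = J 0 (ι z) := by
    intro z
    simp only [hι]
    rw [show J x (y + (N : ℤ) • (z : Site d)) = J (0 + x) (y + (N : ℤ) • (z : Site d)) by rw [zero_add],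
      coupling_add_left hJt]
    congr 1
    abel
  have htail : Summable fun u : {u // u ∉ box d K} => J 0 u := hJs.subtype _
  calc ∑' z : {z : Site d // z ∈ ((↑({0} : Finset (Site d)) : Set (Site d))ᶜ)}, J x (y + (N : ℤ) • (z : Site d))
      = ∑' z : {z : Site d // z ∈ ((↑({0} : Finset (Site d)) : Set (Site d))ᶜ)}, J 0 (ι z) := tsum_congr hterm
    _ ≤ ∑' u : {u // u ∉ box d K}, J 0 u :=
        Summable.tsum_le_tsum_of_inj ι hinj (fun u _ => hJ _ _) (fun _ => le_rfl) (htail.comp_injective hinj) htail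

/-- **The periodised coupling converges to `J`** entrywise as `N → ∞`. [folklore] -/
theorem tendsto_periodicCoupling (hJ : ∀ x y, 0 ≤ J x y) (hJt : ∀ a x y, J (x + a) (y + a) = J x y)
    (hJs : Summable (J 0)) (x y : Site d) :
    Tendsto (fun M : ℕ => periodicCoupling J (M + 1) x y) atTop (𝓝 (J x y)) := by
  rw [Metric.tendsto_atTop]
  intro ε hε
  have ht := tendsto_tail_box (d := d) J
  obtain ⟨K, hK⟩ := (Metric.tendsto_atTop.1 ht) ε hε
  refine ⟨K + Site.supNorm (y - x), fun M hM => ?_⟩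
  have hKM : K + Site.supNorm (y - x) < M + 1 := by omega
  have h1 := periodicCoupling_sub_le_tail (N := M + 1) hJ hJt hJs hKM
  have h2 : J x y ≤ periodicCoupling J (M + 1) x y := le_periodicCoupling hJ hJt hJs x y
  have h3 := hK K le_rfl
  rw [Real.dist_eq, sub_zero, abs_of_nonneg (tsum_nonneg fun _ => hJ _ _)] at h3
  rw [Real.dist_eq, abs_of_nonneg (sub_nonneg.2 h2)]
  linarith

end Periodic

/-! ### Freezing the torus outside a box: the torus state is dominated by a plus-type box state -/

section Freezing

variable {N R : ℕ}

variable (N R) in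
/-- A section of `proj` adapted to the centred box `Λ_R`: `s(a) = (a + proj v)~ - v`, `v = R𝟙`. [folklore] -/
def projSection (a : TorusSite d N) : Site d :=
  torusLift N (a + Torus.proj N (fun _ => (R : ℤ))) - fun _ => (R : ℤ)

/-- `proj ∘ s = id`. [folklore] -/
theorem proj_projSection [NeZero N] (a : TorusSite d N) : Torus.proj N (projSection N R a) = a := by
  rw [projSection, torusProj_sub, proj_torusLift, add_sub_cancel_right]

/-- `s ∘ proj = id` on `Λ_R` when `2R + 1 ≤ N`. [folklore] -/
theorem projSection_proj [NeZero N] (hRN : 2 * R + 1 ≤ N) {x : Site d} (hx : x ∈ box d R) :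
    projSection N R (Torus.proj N x) = x := by
  rw [projSection, ← proj_add_eq, torusLift_proj N]
  · exact add_sub_cancel_right x _
  · rw [mem_box] at hx
    rw [mem_halfOpenBox]
    intro i
    have h := hx i
    simp only [Pi.add_apply]
    constructor
    · omega
    · have : (2 * R + 1 : ℤ) ≤ N := by exact_mod_cast hRN
      omega

/-- `proj` is injective on `Λ_R` when `2R + 1 ≤ N`. [folklore] -/
theorem proj_injOn_box [NeZero N] (hRN : 2 * R + 1 ≤ N) :
    Set.InjOn (Torus.proj (d := d) N) (box d R : Set (Site d)) := by
  intro x hx y hy h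
  rw [← projSection_proj hRN (Finset.mem_coe.1 hx), ← projSection_proj hRN (Finset.mem_coe.1 hy), h]

/-- `s(a) ∈ Λ_R` iff `a ∈ proj(Λ_R)`. [folklore] -/
theorem projSection_mem_iff [NeZero N] (hRN : 2 * R + 1 ≤ N) (a : TorusSite d N) :
    projSection N R a ∈ box d R ↔ a ∈ (box d R).image (Torus.proj N) := by
  constructor
  · intro h
    exact Finset.mem_image.2 ⟨_, h, proj_projSection a⟩
  · intro h
    obtain ⟨x, hx, rfl⟩ := Finset.mem_image.1 h
    rwa [projSection_proj hRN hx]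

variable (N R) in
/-- Extend a configuration of `Λ_R` to the torus `𝕋_N` by `+1` outside `proj(Λ_R)`. [cite: FriedliVelenik2017, Exercise 3.12, p. 112 (configurations frozen to +1 outside a sub-volume)] -/
def extendPlus (τ : SpinConfig ↥(box d R)) : SpinConfig (TorusSite d N) := fun a =>
  if h : projSection N R a ∈ box d R then τ ⟨projSection N R a, h⟩ else 1

/-- On `proj(Λ_R)` the extension reads off `τ`. [folklore] -/
theorem extendPlus_proj [NeZero N] (hRN : 2 * R + 1 ≤ N) (τ : SpinConfig ↥(box d R)) (z : ↥(box d R)) :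
    extendPlus N R τ (Torus.proj N z) = τ z := by
  have h := projSection_proj hRN z.2
  unfold extendPlus
  rw [dif_pos (by rw [h]; exact z.2)]
  congr 1
  exact Subtype.ext h

/-- Outside `proj(Λ_R)` the extension is `+1`. [folklore] -/
theorem extendPlus_of_not_mem [NeZero N] (hRN : 2 * R + 1 ≤ N) (τ : SpinConfig ↥(box d R))
    {a : TorusSite d N} (ha : a ∉ (box d R).image (Torus.proj N)) : extendPlus N R τ a = 1 := by
  unfold extendPlus
  rw [dif_neg]
  rwa [projSection_mem_iff hRN]

/-- `σ_{proj z}(ext τ) = τ_z`. [folklore] -/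
theorem spinAt_proj_extendPlus [NeZero N] (hRN : 2 * R + 1 ≤ N) (τ : SpinConfig ↥(box d R))
    (z : ↥(box d R)) : spinAt (Torus.proj N z) (extendPlus N R τ) = spinAt z τ := by
  rw [spinAt, spinAt, extendPlus_proj hRN]

/-- `σ_a(ext τ) = 1` off `proj(Λ_R)`. [folklore] -/
theorem spinAt_extendPlus_of_not_mem [NeZero N] (hRN : 2 * R + 1 ≤ N) (τ : SpinConfig ↥(box d R))
    {a : TorusSite d N} (ha : a ∉ (box d R).image (Torus.proj N)) : spinAt a (extendPlus N R τ) = 1 := by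
  rw [spinAt, extendPlus_of_not_mem hRN τ ha]
  simp

/-- **Sums over the configurations frozen to `+1` outside `proj(Λ_R)` are sums over the
configurations of `Λ_R`.** [folklore] -/
theorem sum_frozen_eq_sum_extendPlus [NeZero N] (hRN : 2 * R + 1 ≤ N) (g : SpinConfig (TorusSite d N) → ℝ) :
    ∑ ω ∈ univ.filter (fun ω : SpinConfig (TorusSite d N) =>
        ∀ a ∈ univ \ (box d R).image (Torus.proj N), ω a = 1), g ω =
      ∑ τ : SpinConfig ↥(box d R), g (extendPlus N R τ) := by
  symm
  refine Finset.sum_nbij' (fun τ => extendPlus N R τ) (fun ω => fun z => ω (Torus.proj N z)) ?_ ?_ ?_ ?_ ?_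
  · intro τ _
    rw [Finset.mem_filter]
    refine ⟨Finset.mem_univ _, fun a ha => ?_⟩
    exact extendPlus_of_not_mem hRN τ (Finset.mem_sdiff.1 ha).2
  · intro ω _
    exact Finset.mem_univ _
  · intro τ _
    funext z
    exact extendPlus_proj hRN τ z
  · intro ω hω
    rw [Finset.mem_filter] at hω
    funext a
    by_cases ha : projSection N R a ∈ box d R
    · unfold extendPlus
      rw [dif_pos ha]
      show ω (Torus.proj N (projSection N R a)) = ω a
      rw [proj_projSection]
    · unfold extendPlus
      rw [dif_neg ha]
      refine (hω.2 a (Finset.mem_sdiff.2 ⟨Finset.mem_univ _, ?_⟩)).symm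
      rwa [← projSection_mem_iff hRN]
  · intro τ _
    rfl

/-- The spin product at projected sites of the extension is the spin product on the box. [folklore] -/
theorem spinProduct_image_extendPlus [NeZero N] (hRN : 2 * R + 1 ≤ N) (τ : SpinConfig ↥(box d R))
    {A : Finset (Site d)} (hA : A ⊆ box d R) :
    spinProduct (A.image (Torus.proj N)) (extendPlus N R τ) = spinProduct (inVol (box d R) A) τ := by
  rw [spinProduct, spinProduct, Finset.prod_image fun x hx y hy h => proj_injOn_box hRN (hA hx) (hA hy) h]
  rw [← prod_inVol_of_subset hA (fun x => spinAt (Torus.proj N x) (extendPlus N R τ))]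
  exact Finset.prod_congr rfl fun z _ => spinAt_proj_extendPlus hRN τ z

/-- The energy identity of the box system with site-dependent fields:
`∑ᵢ Kᵢ τ_{Cᵢ} = (β/2)∑_{z,w∈Λ} c_{z,w}τ_zτ_w + β∑_{z∈Λ} hf(z)τ_z`. [cite: FriedliVelenik2017, §3.8.1, p. 141] -/
theorem gksHamiltonian_finCoupling (Λ : Finset (Site d)) (c : Site d → Site d → ℝ) (β : ℝ) (hf : Site d → ℝ)
    (τ : SpinConfig ↥Λ) :
    gksHamiltonian univ (finCoupling Λ c β hf) (finSupp Λ) τ =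
      β / 2 * ∑ z : ↥Λ, ∑ w : ↥Λ, c z w * spinAt z τ * spinAt w τ + β * ∑ z : ↥Λ, hf z * spinAt z τ := by
  rw [gksHamiltonian, Fintype.sum_sum_type, Fintype.sum_prod_type]
  simp only [finCoupling_inl, finCoupling_inr, finSupp_inl, finSupp_inr, ← spinAt_mul_spinAt_eq_spinProduct,
    spinProduct_singleton_eq_spinAt]
  rw [Finset.mul_sum, Finset.mul_sum]
  congr 1
  · refine Finset.sum_congr rfl fun z _ => ?_
    rw [Finset.mul_sum]
    exact Finset.sum_congr rfl fun w _ => by ring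
  · exact Finset.sum_congr rfl fun z _ => by ring

/-- **The torus energy of an extended configuration**: for a symmetric coupling matrix `c` on `𝕋_N`,
`∑_{a,b} c_{a,b}σ_aσ_b (ext τ) = ∑_{z,w∈Λ_R} c_{pz,pw}τ_zτ_w + 2∑_{z∈Λ_R} τ_z ∑_{b∉P} c_{pz,b} + ∑_{a,b∉P} c_{a,b}`,
`P = proj(Λ_R)`. [folklore] -/
theorem torusEnergy_extendPlus [NeZero N] (hRN : 2 * R + 1 ≤ N) (c : TorusSite d N → TorusSite d N → ℝ)
    (hc : ∀ a b, c a b = c b a) (τ : SpinConfig ↥(box d R)) :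
    ∑ a, ∑ b, c a b * spinAt a (extendPlus N R τ) * spinAt b (extendPlus N R τ) =
      ∑ z : ↥(box d R), ∑ w : ↥(box d R),
          c (Torus.proj N z) (Torus.proj N w) * spinAt z τ * spinAt w τ +
        2 * ∑ z : ↥(box d R), spinAt z τ *
          ∑ b ∈ univ \ (box d R).image (Torus.proj N), c (Torus.proj N z) b +
        ∑ a ∈ univ \ (box d R).image (Torus.proj N), ∑ b ∈ univ \ (box d R).image (Torus.proj N), c a b := by
  set σ := extendPlus N R τ with hσ
  set P : Finset (TorusSite d N) := (box d R).image (Torus.proj N) with hP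
  have hPu : P ⊆ univ := Finset.subset_univ P
  have hinj : Set.InjOn (Torus.proj (d := d) N) (box d R : Set (Site d)) := proj_injOn_box hRN
  have hout : ∀ b ∈ univ \ P, spinAt b σ = 1 := fun b hb =>
    spinAt_extendPlus_of_not_mem hRN τ (Finset.mem_sdiff.1 hb).2
  -- sums over `P` are sums over the box
  have hPsum : ∀ F : TorusSite d N → ℝ, ∑ a ∈ P, F a = ∑ z : ↥(box d R), F (Torus.proj N z) := by
    intro F
    rw [hP, Finset.sum_image fun x hx y hy h => hinj hx hy h, ← Finset.sum_coe_sort]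
  -- split the inner sums
  have hinner : ∀ a, ∑ b, c a b * spinAt a σ * spinAt b σ =
      spinAt a σ * (∑ w : ↥(box d R), c a (Torus.proj N w) * spinAt w τ) +
        spinAt a σ * ∑ b ∈ univ \ P, c a b := by
    intro a
    rw [← Finset.sum_sdiff hPu, hPsum, add_comm, Finset.mul_sum, Finset.mul_sum]
    congr 1
    · refine Finset.sum_congr rfl fun w _ => ?_
      rw [spinAt_proj_extendPlus hRN]
      ring
    · refine Finset.sum_congr rfl fun b hb => ?_
      rw [hout b hb]
      ring
  simp_rw [hinner]
  rw [← Finset.sum_sdiff hPu, hPsum]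
  simp_rw [hσ, spinAt_proj_extendPlus hRN]
  -- the outer sum over the complement: spins are `1`
  have hcomp : ∑ a ∈ univ \ P, (spinAt a σ * ∑ w : ↥(box d R), c a (Torus.proj N w) * spinAt w τ +
      spinAt a σ * ∑ b ∈ univ \ P, c a b) =
      ∑ z : ↥(box d R), spinAt z τ * ∑ b ∈ univ \ P, c (Torus.proj N z) b +
        ∑ a ∈ univ \ P, ∑ b ∈ univ \ P, c a b := by
    rw [Finset.sum_add_distrib]
    congr 1
    · rw [Finset.sum_congr rfl fun a ha => by rw [hout a ha, one_mul], Finset.sum_comm]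
      refine Finset.sum_congr rfl fun z _ => ?_
      rw [Finset.mul_sum]
      refine Finset.sum_congr rfl fun a _ => ?_
      rw [hc]
      ring
    · exact Finset.sum_congr rfl fun a ha => by rw [hout a ha, one_mul]
  rw [hcomp, Finset.sum_add_distrib]
  have hbox : ∑ z : ↥(box d R), spinAt z τ * ∑ w : ↥(box d R), c (Torus.proj N z) (Torus.proj N w) * spinAt w τ =
      ∑ z : ↥(box d R), ∑ w : ↥(box d R), c (Torus.proj N z) (Torus.proj N w) * spinAt z τ * spinAt w τ := by
    refine Finset.sum_congr rfl fun z _ => ?_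
    rw [Finset.mul_sum]
    exact Finset.sum_congr rfl fun w _ => by ring
  rw [hbox]
  ring

/-- **The torus weight of an extended configuration is the weight of the box system with the
periodised couplings and the frozen-spin fields, up to a constant factor.** [folklore] -/
theorem torusWeight_extendPlus [NeZero N] (hRN : 2 * R + 1 ≤ N) (c : TorusSite d N → TorusSite d N → ℝ)
    (hc : ∀ a b, c a b = c b a) (β : ℝ) (τ : SpinConfig ↥(box d R)) :
    torusWeight c β 0 (extendPlus N R τ) =
      Real.exp (β / 2 * ∑ a ∈ univ \ (box d R).image (Torus.proj N),
          ∑ b ∈ univ \ (box d R).image (Torus.proj N), c a b) *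
        gksWeight univ
          (finCoupling (box d R) (fun x y => c (Torus.proj N x) (Torus.proj N y)) β
            (fun x => ∑ b ∈ univ \ (box d R).image (Torus.proj N), c (Torus.proj N x) b))
          (finSupp (box d R)) τ := by
  rw [torusWeight, torusHamiltonian, gksWeight, gksHamiltonian_finCoupling, ← Real.exp_add,
    torusEnergy_extendPlus hRN c hc τ]
  congr 1
  simp only [zero_mul, sub_zero]
  have e : ∑ z : ↥(box d R), (∑ b ∈ univ \ (box d R).image (Torus.proj N), c (Torus.proj N z) b) * spinAt z τ =
      ∑ z : ↥(box d R), spinAt z τ * ∑ b ∈ univ \ (box d R).image (Torus.proj N), c (Torus.proj N z) b :=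
    Finset.sum_congr rfl fun z _ => mul_comm _ _
  rw [e]
  ring

/-- **Freezing the torus outside a box** (GKS): for `c ≥ 0` symmetric, `β ≥ 0`, `A ⊆ Λ_R`, `2R+1 ≤ N`,
`⟨σ_{Ā}⟩_{𝕋_N,c,0,β} ≤ ⟨σ_A⟩_{Λ_R; c∘proj, h, β}` with the frozen-spin fields `h(x) = ∑_{b∉proj Λ_R} c_{proj x,b}`. [cite: FriedliVelenik2017, Exercise 3.12, p. 112 (⟨σ_A⟩ rises when spins are frozen to +1; GKS)] -/
theorem torusExpect_spinProduct_le_finCorr [NeZero N] (hRN : 2 * R + 1 ≤ N) {β : ℝ} (hβ : 0 ≤ β)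
    (c : TorusSite d N → TorusSite d N → ℝ) (hc0 : ∀ a b, 0 ≤ c a b) (hc : ∀ a b, c a b = c b a)
    {A : Finset (Site d)} (hA : A ⊆ box d R) :
    torusExpect c β 0 (spinProduct (A.image (Torus.proj N))) ≤
      finCorr (box d R) (fun x y => c (Torus.proj N x) (Torus.proj N y)) β
        (fun x => ∑ b ∈ univ \ (box d R).image (Torus.proj N), c (Torus.proj N x) b) A := by
  classical
  rw [torusExpect_eq_gksExpect]
  set Kt := (Sum.elim (fun p : TorusSite d N × TorusSite d N => β / 2 * c p.1 p.2) fun _ => β * (0 : ℝ)) with hKt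
  set Ct := (Sum.elim (fun p : TorusSite d N × TorusSite d N => ({p.1} ∆ {p.2} : Finset (TorusSite d N))) fun a => {a}) with hCt
  have hK : ∀ i ∈ (univ : Finset ((TorusSite d N × TorusSite d N) ⊕ TorusSite d N)), 0 ≤ Kt i :=
    fun i _ => torusGksCoupling_nonneg c β 0 hβ le_rfl hc0 i
  refine (gksExpect_le_frozen univ Kt Ct hK (univ \ (box d R).image (Torus.proj N)) (A.image (Torus.proj N))).trans
    (le_of_eq ?_)
  have hw : ∀ ω, gksWeight univ Kt Ct ω = torusWeight c β 0 ω := fun ω => (torusWeight_eq_gksWeight c β 0 ω).symm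
  simp_rw [hw]
  rw [sum_frozen_eq_sum_extendPlus hRN, sum_frozen_eq_sum_extendPlus hRN]
  simp_rw [torusWeight_extendPlus hRN c hc β, spinProduct_image_extendPlus hRN _ hA]
  set E := Real.exp (β / 2 * ∑ a ∈ univ \ (box d R).image (Torus.proj N),
      ∑ b ∈ univ \ (box d R).image (Torus.proj N), c a b) with hE
  rw [finCorr, gksExpect, gksSum, gksSum]
  have hnum : ∑ τ : SpinConfig ↥(box d R), spinProduct (inVol (box d R) A) τ *
      (E * gksWeight univ (finCoupling (box d R) (fun x y => c (Torus.proj N x) (Torus.proj N y)) β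
        (fun x => ∑ b ∈ univ \ (box d R).image (Torus.proj N), c (Torus.proj N x) b)) (finSupp (box d R)) τ) =
      E * ∑ τ : SpinConfig ↥(box d R), spinProduct (inVol (box d R) A) τ *
        gksWeight univ (finCoupling (box d R) (fun x y => c (Torus.proj N x) (Torus.proj N y)) β
          (fun x => ∑ b ∈ univ \ (box d R).image (Torus.proj N), c (Torus.proj N x) b)) (finSupp (box d R)) τ := by
    rw [Finset.mul_sum]
    exact Finset.sum_congr rfl fun τ _ => by ring
  rw [hnum, ← Finset.mul_sum, mul_div_mul_left _ _ (Real.exp_pos _).ne']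
  simp only [one_mul]

end Freezing

/-! ### Continuity of the box state in the couplings; the torus state through the periodised box state -/

section Continuity

variable {Λ' : Type*} [Fintype Λ'] [DecidableEq Λ'] {ι : Type*}

/-- The unnormalised expectation is continuous in the coupling vector (finite sums of exponentials). [folklore] -/
theorem continuous_gksSum (s : Finset ι) (C : ι → Finset Λ') (f : SpinConfig Λ' → ℝ) :
    Continuous fun K : ι → ℝ => gksSum s K C f := by
  unfold gksSum gksWeight gksHamiltonian
  refine continuous_finsetSum _ fun ω _ => continuous_const.mul (Real.continuous_exp.comp ?_)
  exact continuous_finsetSum _ fun i _ => (continuous_apply i).mul continuous_const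

/-- **The expectation `⟨f⟩_{Λ;K}` is continuous in `K`.** [folklore] -/
theorem continuous_gksExpect (s : Finset ι) (C : ι → Finset Λ') (f : SpinConfig Λ' → ℝ) :
    Continuous fun K : ι → ℝ => gksExpect s K C f :=
  (continuous_gksSum s C f).div (continuous_gksSum s C fun _ => 1) fun K => (gksSum_one_pos s K C).ne'

end Continuity

section TorusToBox

variable {J : Site d → Site d → ℝ} {β : ℝ}

/-- The couplings of the box converge: `finCoupling Λ J^{(M+1)} β hf → finCoupling Λ J β hf`. [folklore] -/
theorem tendsto_finCoupling_periodic (hJ : ∀ x y, 0 ≤ J x y) (hJt : ∀ a x y, J (x + a) (y + a) = J x y)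
    (hJs : Summable (J 0)) (Λ : Finset (Site d)) (hf : Site d → ℝ) :
    Tendsto (fun M : ℕ => finCoupling Λ (periodicCoupling J (M + 1)) β hf) atTop
      (𝓝 (finCoupling Λ J β hf)) := by
  rw [tendsto_pi_nhds]
  rintro (p | z)
  · simp only [finCoupling_inl]
    exact (tendsto_periodicCoupling hJ hJt hJs _ _).const_mul _
  · simp only [finCoupling_inr]
    exact tendsto_const_nhds

/-- **The box state with the periodised couplings converges to the box state of `J`** (any observable). [folklore] -/
theorem tendsto_gksExpect_periodic (hJ : ∀ x y, 0 ≤ J x y) (hJt : ∀ a x y, J (x + a) (y + a) = J x y)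
    (hJs : Summable (J 0)) (Λ : Finset (Site d)) (hf : Site d → ℝ) (f : SpinConfig ↥Λ → ℝ) :
    Tendsto (fun M : ℕ => gksExpect univ (finCoupling Λ (periodicCoupling J (M + 1)) β hf) (finSupp Λ) f) atTop
      (𝓝 (gksExpect univ (finCoupling Λ J β hf) (finSupp Λ) f)) :=
  ((continuous_gksExpect univ (finSupp Λ) f).tendsto _).comp (tendsto_finCoupling_periodic hJ hJt hJs Λ hf)

variable {N R : ℕ}

/-- `J^{(N)}` on the torus is symmetric for symmetric translation-invariant `J`. [folklore] -/
theorem torusCoupling_symm (hJt : ∀ a x y, J (x + a) (y + a) = J x y) (hJsym : ∀ x y, J x y = J y x) [NeZero N]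
    (a b : TorusSite d N) : torusCoupling J N a b = torusCoupling J N b a := by
  rw [← proj_torusLift N a, ← proj_torusLift N b, torusCoupling_proj_proj hJt, torusCoupling_proj_proj hJt,
    periodicCoupling_symm hJt hJsym]

/-- The frozen-spin fields of the torus are at most the plus fields of the box:
`∑_{b∉proj Λ_R} J^{(N)}_{proj x,b} ≤ h⁺_{Λ_R}(x)`. [folklore] -/
theorem torusFrozenField_le_plusField (hJ : ∀ x y, 0 ≤ J x y) (hJt : ∀ a x y, J (x + a) (y + a) = J x y)
    (hJs : Summable (J 0)) [NeZero N] (hRN : 2 * R + 1 ≤ N) (x : Site d) :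
    ∑ b ∈ univ \ (box d R).image (Torus.proj N), torusCoupling J N (Torus.proj N x) b ≤ plusField J (box d R) x := by
  have hsplit := Finset.sum_sdiff (f := fun b => torusCoupling J N (Torus.proj N x) b)
    (Finset.subset_univ ((box d R).image (Torus.proj N)))
  have htot : ∑ b, torusCoupling J N (Torus.proj N x) b = ∑' w, J x w := by
    rw [sum_torusCoupling_eq_tsum J N hJt hJs, (summable_row J hJt hJs _).2, (summable_row J hJt hJs x).2]
  have hin : ∑ b ∈ (box d R).image (Torus.proj N), torusCoupling J N (Torus.proj N x) b =
      ∑ y ∈ box d R, periodicCoupling J N x y := by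
    rw [Finset.sum_image fun a ha b hb h => proj_injOn_box hRN ha hb h]
    exact Finset.sum_congr rfl fun y _ => torusCoupling_proj_proj hJt x y
  have hle : ∑ y ∈ box d R, J x y ≤ ∑ y ∈ box d R, periodicCoupling J N x y :=
    Finset.sum_le_sum fun y _ => le_periodicCoupling hJ hJt hJs x y
  rw [plusField]
  linarith [hsplit, htot, hin, hle]

/-- **The torus state is dominated by the plus-type box state with the periodised couplings**:
for `J ≥ 0` symmetric, translation invariant with summable rows, `β ≥ 0`, `A ⊆ Λ_R`, `2R+1 ≤ N`,
`⟨σ_{Ā}⟩_{𝕋_N,J^{(N)},β} ≤ ⟨σ_A⟩_{Λ_R; J^{(N)}, h⁺_{Λ_R}, β}`. [cite: FriedliVelenik2017, Exercise 3.12 with Exercise 3.31] -/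
theorem torusExpect_le_plusBox_periodic (hβ : 0 ≤ β) (hJ : ∀ x y, 0 ≤ J x y)
    (hJt : ∀ a x y, J (x + a) (y + a) = J x y) (hJs : Summable (J 0)) (hJsym : ∀ x y, J x y = J y x)
    [NeZero N] (hRN : 2 * R + 1 ≤ N) {A : Finset (Site d)} (hA : A ⊆ box d R) :
    torusExpect (torusCoupling J N) β 0 (spinProduct (A.image (Torus.proj N))) ≤
      finCorr (box d R) (periodicCoupling J N) β (plusField J (box d R)) A := by
  have h1 := torusExpect_spinProduct_le_finCorr hRN hβ (torusCoupling J N)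
    (torusCoupling_nonneg J N hJ) (torusCoupling_symm hJt hJsym) hA
  have hc : (fun x y => torusCoupling J N (Torus.proj N x) (Torus.proj N y)) = periodicCoupling J N := by
    funext x y
    exact torusCoupling_proj_proj hJt x y
  rw [hc] at h1
  refine h1.trans (finCorr_mono hβ (fun x _ y _ => ?_) (fun x _ => ?_) A)
  · rw [abs_of_nonneg (periodicCoupling_nonneg hJ x y)]
  · rw [abs_of_nonneg (Finset.sum_nonneg fun b _ => torusCoupling_nonneg J N hJ _ _)]
    exact torusFrozenField_le_plusField hJ hJt hJs hRN x

end TorusToBox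

/-! ### The torus two-point function converges to the free two-point function when `m*(β) = 0` -/

section TorusLimit

variable {J : Site d → Site d → ℝ} {β : ℝ}

/-- `σ_{{a,b}} = σ_aσ_b` for `a ≠ b`. [folklore] -/
theorem spinProduct_pair {V : Type*} [DecidableEq V] {a b : V} (h : a ≠ b) (σ : SpinConfig V) :
    spinProduct ({a, b} : Finset V) σ = spinAt a σ * spinAt b σ := by
  rw [spinProduct, Finset.prod_pair h]

/-- The trace of a pair of sites of `Λ` on `Λ`. [folklore] -/
theorem inVol_insert_pair {Λ : Finset (Site d)} {x y : Site d} (hx : x ∈ Λ) (hy : y ∈ Λ) :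
    inVol Λ ({x, y} : Finset (Site d)) = {⟨x, hx⟩, ⟨y, hy⟩} := by
  ext w
  rw [mem_inVol, Finset.mem_insert, Finset.mem_singleton, Finset.mem_insert, Finset.mem_singleton,
    Subtype.ext_iff, Subtype.ext_iff]

/-- Translates of a box: `a ∈ Λ_R`, `|z|_∞ = L` give `a + z ∈ Λ_{R+L}`. [folklore] -/
theorem add_mem_box_add {R : ℕ} {a z : Site d} (ha : a ∈ box d R) : a + z ∈ box d (R + Site.supNorm z) := by
  rw [mem_box] at ha ⊢
  have hz := (Site.supNorm_le_iff (x := z) (n := Site.supNorm z)).1 le_rfl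
  intro i
  have h1 := ha i
  have h2 := hz i
  simp only [Pi.add_apply]
  push_cast
  omega

/-- **GHS step**: the plus-type two-point function of a box is at most the infinite-volume free
two-point function plus a plus-type one-point function:
`⟨σ_aσ_{a+z}⟩_{Λ;J,h⁺,β} ≤ S_β(z) + ⟨σ_a⟩_{Λ;J,h⁺,β}` (`z ≠ 0`, `a, a+z ∈ Λ`). [cite: Lebowitz1974, §2, Remark (ii) (the truncated pair function decreases in the fields)] -/
theorem plusBox_pair_le (hβ : 0 ≤ β) (hJ : ∀ x y, 0 ≤ J x y) (hJt : ∀ a x y, J (x + a) (y + a) = J x y)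
    (hJs : Summable (J 0)) {Λ : Finset (Site d)} {a z : Site d} (hz : z ≠ 0) (ha : a ∈ Λ) (haz : a + z ∈ Λ) :
    finCorr Λ J β (plusField J Λ) {a, a + z} ≤
      pairCorrelation J β 0 z + gksExpect univ (finCoupling Λ J β (plusField J Λ)) (finSupp Λ) (spinProduct {⟨a, ha⟩}) := by
  have hne : a ≠ a + z := fun h => hz (left_eq_add.1 h)
  have hne' : (⟨a, ha⟩ : ↥Λ) ≠ ⟨a + z, haz⟩ := fun h => hne (congrArg Subtype.val h)
  have hpf := plusField_nonneg (Λ := Λ) hJ hJt hJs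
  have hpair : ∀ hf : Site d → ℝ, finCorr Λ J β hf {a, a + z} =
      gksExpect univ (finCoupling Λ J β hf) (finSupp Λ) (fun τ => spinAt (⟨a, ha⟩ : ↥Λ) τ * spinAt (⟨a + z, haz⟩ : ↥Λ) τ) := by
    intro hf
    rw [finCorr, inVol_insert_pair ha haz]
    congr 1
    funext τ
    exact spinProduct_pair hne' τ
  rw [spinProduct_singleton_eq_spinAt, hpair]
  refine (finPair_le_finPair_zero_add hβ hJ hpf _ _).trans ?_
  -- the free two-point function of the box is at most `S_β(z)`
  have hfree : gksExpect univ (finCoupling Λ J β (fun _ => 0)) (finSupp Λ)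
      (fun τ => spinAt (⟨a, ha⟩ : ↥Λ) τ * spinAt (⟨a + z, haz⟩ : ↥Λ) τ) ≤ pairCorrelation J β 0 z := by
    rw [← hpair, ← expectIn_spinProduct_eq_finCorr]
    have h1 := expectIn_le_state J β hβ hJ (Λ := Λ) (A := {a, a + z})
      (Finset.insert_subset_iff.2 ⟨ha, Finset.singleton_subset_iff.2 haz⟩)
    have h2 : state J β 0 (spinProduct ({a, a + z} : Finset (Site d))) = pairCorrelation J β 0 z := by
      rw [← pairCorrelation_add J β hβ hJ hJt a 0 z, zero_add, add_comm z a, pairCorrelation_eq,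
        Disjoint.symmDiff_eq_sup (Finset.disjoint_singleton.2 hne)]
      rfl
    exact h1.trans_eq h2
  -- the one-point functions are in `[0,1]`
  have hm1 : gksExpect univ (finCoupling Λ J β (plusField J Λ)) (finSupp Λ) (spinAt (⟨a + z, haz⟩ : ↥Λ)) ≤ 1 :=
    (le_abs_self _).trans (abs_gksExpect_spinAt_le_one _ _ _ _)
  have hm0 : 0 ≤ gksExpect univ (finCoupling Λ J β (plusField J Λ)) (finSupp Λ) (spinAt (⟨a, ha⟩ : ↥Λ)) := by
    rw [← spinProduct_singleton_eq_spinAt]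
    exact gksExpect_spinProduct_nonneg _ _ _ (fun i _ => finCoupling_nonneg hβ hJ hpf i) _
  nlinarith [hfree, hm1, hm0, mul_le_mul_of_nonneg_left hm1 hm0]

/-- **Translation on the torus**: `⟨σ₀σ_{z̄}⟩_{𝕋_M} = ⟨σ_{proj{a,a+z}}⟩_{𝕋_M}` (`z ≠ 0`, `a, a+z ∈ Λ_R`,
`2R+1 ≤ M`). [folklore] -/
theorem torusPair_eq_torusExpect_image (hJt : ∀ a x y, J (x + a) (y + a) = J x y) {M R : ℕ} [NeZero M]
    (hRM : 2 * R + 1 ≤ M) {a z : Site d} (hz : z ≠ 0) (ha : a ∈ box d R) (haz : a + z ∈ box d R) :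
    torusExpect (torusCoupling J M) β 0 (fun σ => spinAt 0 σ * spinAt (Torus.proj M z) σ) =
      torusExpect (torusCoupling J M) β 0 (spinProduct (({a, a + z} : Finset (Site d)).image (Torus.proj M))) := by
  have hne : Torus.proj M a ≠ Torus.proj M (a + z) := fun h =>
    hz (left_eq_add.1 (proj_injOn_box hRM ha haz h))
  have himg : ({a, a + z} : Finset (Site d)).image (Torus.proj M) = {Torus.proj M a, Torus.proj M (a + z)} := by
    rw [Finset.image_insert, Finset.image_singleton]
  rw [himg]
  have h1 : spinProduct ({Torus.proj M a, Torus.proj M (a + z)} : Finset (TorusSite d M)) =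
      fun σ => (fun τ : SpinConfig (TorusSite d M) => spinAt 0 τ * spinAt (Torus.proj M z) τ)
        (σ ∘ Equiv.addRight (Torus.proj M a)) := by
    funext σ
    rw [spinProduct_pair hne]
    simp only [spinAt_comp_torus, Equiv.coe_addRight, zero_add, proj_add_eq]
    rw [add_comm (Torus.proj M a)]
  rw [h1]
  exact (torusExpect_comp_equiv _ β 0 (Equiv.addRight (Torus.proj M a))
    (fun x y => torusCoupling_add_right J M hJt x y _) (fun τ => spinAt 0 τ * spinAt (Torus.proj M z) τ)).symm

/-- Sums of nonnegative functions of the sites of a sub-box are dominated by sums over the box. [folklore] -/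
theorem sum_box_le_sum_univ {Λ : Finset (Site d)} {R : ℕ} (hR : box d R ⊆ Λ) (g : ↥Λ → ℝ) (hg : ∀ w, 0 ≤ g w) :
    ∑ a ∈ (box d R).attach, g ⟨a, hR a.2⟩ ≤ ∑ w : ↥Λ, g w := by
  set e : ↥(box d R) ↪ ↥Λ := ⟨fun a => ⟨a, hR a.2⟩, fun a b h => by
    apply Subtype.ext
    have := congrArg Subtype.val h
    simpa using this⟩ with he
  have h1 : ∑ a ∈ (box d R).attach, g ⟨a, hR a.2⟩ = ∑ w ∈ (box d R).attach.map e, g w := by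
    rw [Finset.sum_map]
    rfl
  rw [h1]
  exact Finset.sum_le_sum_of_subset_of_nonneg (Finset.subset_univ _) fun w _ _ => hg w

/-- **The torus two-point function converges to the infinite-volume free two-point function when the
magnetisation vanishes**: for `β > 0`, `J ≥ 0` symmetric, translation invariant with summable rows and
`m*(β) = 0`, for every `z` and `ε > 0`, `|⟨σ₀σ_{z̄}⟩_{𝕋_M,J^{(M)},β} - S_β(z)| ≤ ε` for all large `M`. [cite: Panis2023Triviality, proof of Proposition 3.7 (⟨τ₀τ_x⟩_{𝕋_L,ρ,β} → ⟨τ₀τ_x⟩_{ρ,β} below β_c(ρ))] [cite: FriedliVelenik2017, §3.7.2 ("when h = 0, uniqueness is equivalent to m*(β) = 0"), Remark 3.30] -/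
theorem abs_torusPair_sub_pairCorrelation_le (hβ : 0 < β) (hJ : ∀ x y, 0 ≤ J x y)
    (hJt : ∀ a x y, J (x + a) (y + a) = J x y) (hJs : Summable (J 0)) (hJsym : ∀ x y, J x y = J y x)
    (hm : magnetization J β = 0) (z : Site d) {ε : ℝ} (hε : 0 < ε) :
    ∃ N₀ : ℕ, ∀ M : ℕ, [NeZero M] → N₀ ≤ M →
      |torusExpect (torusCoupling J M) β 0 (fun σ => spinAt 0 σ * spinAt (Torus.proj M z) σ) -
          pairCorrelation J β 0 z| ≤ ε := by
  by_cases hz : z = 0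
  · subst hz
    refine ⟨0, fun M _ _ => ?_⟩
    have h1 : torusExpect (torusCoupling J M) β 0 (fun σ => spinAt 0 σ * spinAt (Torus.proj M 0) σ) = 1 := by
      have : (fun σ : SpinConfig (TorusSite d M) => spinAt 0 σ * spinAt (Torus.proj M 0) σ) = fun _ => 1 := by
        funext σ; simp
      rw [this, torusExpect_const]
    rw [h1, pairCorrelation_self, sub_self, abs_zero]
    exact hε.le
  set S := pairCorrelation J β 0 z with hS
  set L := Site.supNorm z with hL
  have hzL : z ∈ box d L := mem_box_iff_supNorm_le.2 le_rfl
  ---------------------------------------------------------------- lower bound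
  have hlow : ∃ N₁ : ℕ, ∀ M : ℕ, [NeZero M] → N₁ ≤ M →
      S - ε ≤ torusExpect (torusCoupling J M) β 0 (fun σ => spinAt 0 σ * spinAt (Torus.proj M z) σ) := by
    have ht := tendsto_expectIn_box J β hβ.le hJ (({0} : Finset (Site d)) ∆ {z})
    rw [← pairCorrelation_eq] at ht
    have hev := (tendsto_order.1 ht).1 (S - ε) (by linarith)
    obtain ⟨n₁, hn₁⟩ := eventually_atTop.1 hev
    set n := max n₁ L with hn
    refine ⟨2 * n + 1, fun M _ hM => ?_⟩
    have hsub : (({0} : Finset (Site d)) ∆ {z}) ⊆ box d n := by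
      intro x hx
      rw [Finset.mem_symmDiff, Finset.mem_singleton, Finset.mem_singleton] at hx
      rcases hx with ⟨rfl, -⟩ | ⟨rfl, -⟩
      · exact zero_mem_box d n
      · exact box_mono d (le_max_right n₁ L) hzL
    have h1 := expectIn_box_spinProduct_le_torusExpect J M β 0 hβ.le le_rfl hJ hJt hJs hM hsub
    rw [spinProduct_image_proj_pair M (fun hz0 => proj_ne_zero_of_mem_box (by omega) hzL hz0)] at h1
    exact (hn₁ n (le_max_left _ _)).le.trans h1
  ---------------------------------------------------------------- upper bound: parameters
  set Cd : ℝ := (2 : ℝ) ^ d with hCd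
  have hCd0 : 0 < Cd := by positivity
  -- a field `δ > 0` with `m^f(δ) ≤ ε/(8 Cd)`
  obtain ⟨δ, hδ, hmδ⟩ : ∃ δ : ℝ, 0 < δ ∧ state J β δ (spinAt 0) ≤ ε / (8 * Cd) := by
    have ht := tendsto_state_magnetization J β hβ.le hJ
    rw [hm] at ht
    have hev := (tendsto_order.1 ht).2 (ε / (8 * Cd)) (by positivity)
    obtain ⟨h, hh1, hh2⟩ := (hev.and self_mem_nhdsWithin).exists
    exact ⟨h, hh2, hh1.le⟩
  -- boxes with small plus fields: `D_{Λ_{R'}} ≤ η |Λ_{R'}|`, `η = εδ/(16 Cd)`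
  obtain ⟨R₀, hR₀⟩ := sum_box_plusField_le_eventually (d := d) hJ hJt hJs (show 0 < ε * δ / (16 * Cd) by positivity)
  set R : ℕ := max L R₀ with hR
  set R' : ℕ := R + L with hR'
  set Λ := box d R' with hΛ
  have hLR : L ≤ R := le_max_left _ _
  have hbox : box d R ⊆ Λ := box_mono d (Nat.le_add_right R L)
  have hmemz : ∀ a ∈ box d R, a + z ∈ Λ := fun a ha => add_mem_box_add ha
  -- the plus-type pair functions of `Λ` and their limits
  set P : ℕ → Site d → ℝ := fun M a => finCorr Λ (periodicCoupling J M) β (plusField J Λ) {a, a + z} with hP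
  set Pinf : Site d → ℝ := fun a => finCorr Λ J β (plusField J Λ) {a, a + z} with hPinf
  have hPt : ∀ a, Tendsto (fun M : ℕ => P (M + 1) a) atTop (𝓝 (Pinf a)) := fun a =>
    tendsto_gksExpect_periodic hJ hJt hJs Λ (plusField J Λ) _
  have hAvg : Tendsto (fun M : ℕ => ∑ a ∈ box d R, P (M + 1) a) atTop (𝓝 (∑ a ∈ box d R, Pinf a)) :=
    tendsto_finsetSum _ fun a _ => hPt a
  obtain ⟨M₁, hM₁⟩ := (Metric.tendsto_atTop.1 hAvg) (ε / 4 * #(box d R)) (by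
    have : (0 : ℝ) < #(box d R) := by exact_mod_cast Finset.card_pos.2 (box_nonempty d R)
    positivity)
  ---------------------------------------------------------------- the bound on the limit average
  have hcard : (0 : ℝ) < #(box d R) := by exact_mod_cast Finset.card_pos.2 (box_nonempty d R)
  have hcardΛ : (#Λ : ℝ) ≤ Cd * #(box d R) := by
    rw [hΛ, card_box, card_box, hCd]
    push_cast
    rw [← mul_pow]
    apply pow_le_pow_left₀ (by positivity)
    have : (L : ℝ) ≤ R := by exact_mod_cast hLR
    push_cast [hR']
    linarith
  have hPinf_le : ∀ a (ha : a ∈ box d R), Pinf a ≤ S + gksExpect univ (finCoupling Λ J β (plusField J Λ)) (finSupp Λ)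
      (spinProduct {⟨a, hbox ha⟩}) := fun a ha =>
    plusBox_pair_le hβ.le hJ hJt hJs hz (hbox ha) (hmemz a ha)
  have hsumPinf : ∑ a ∈ box d R, Pinf a ≤ #(box d R) * S + Cd * #(box d R) * (ε / (4 * Cd)) := by
    -- sum of the one-point functions over the sub-box ≤ sum over `Λ` ≤ `|Λ| m^f(δ) + 2D/δ`
    have h1 : ∑ a ∈ box d R, Pinf a ≤ ∑ a ∈ (box d R).attach, (S + gksExpect univ (finCoupling Λ J β (plusField J Λ))
        (finSupp Λ) (spinProduct {⟨a, hbox a.2⟩})) := by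
      rw [← Finset.sum_attach (box d R) Pinf]
      exact Finset.sum_le_sum fun a _ => hPinf_le a a.2
    have h2 : ∑ a ∈ (box d R).attach, (S + gksExpect univ (finCoupling Λ J β (plusField J Λ))
        (finSupp Λ) (spinProduct {⟨a, hbox a.2⟩})) =
        #(box d R) * S + ∑ a ∈ (box d R).attach, gksExpect univ (finCoupling Λ J β (plusField J Λ))
          (finSupp Λ) (spinProduct {⟨a, hbox a.2⟩}) := by
      rw [Finset.sum_add_distrib, Finset.sum_const, Finset.card_attach, nsmul_eq_mul]
    have h3 := sum_box_le_sum_univ hbox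
      (fun w => gksExpect univ (finCoupling Λ J β (plusField J Λ)) (finSupp Λ) (spinProduct {w}))
      (fun w => gksExpect_spinProduct_nonneg _ _ _
        (fun i _ => finCoupling_nonneg hβ.le hJ (plusField_nonneg (Λ := Λ) hJ hJt hJs) i) _)
    have h4 := sum_plusOnePoint_le hβ hJ hJt hJs Λ hδ
    have h5 : ∑ x ∈ Λ, plusField J Λ x ≤ ε * δ / (16 * Cd) * #Λ := by
      have := hR₀ R' (le_trans (le_max_right L R₀) (Nat.le_add_right R L))
      rw [hΛ]
      exact this
    have h6 : (#Λ : ℝ) * state J β δ (spinAt 0) + 2 * (∑ x ∈ Λ, plusField J Λ x) / δ ≤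
        Cd * #(box d R) * (ε / (4 * Cd)) := by
      have hΛ0 : (0 : ℝ) ≤ #Λ := by positivity
      have hst0 : 0 ≤ state J β δ (spinAt 0) := by
        rw [← spinProduct_singleton_eq_spinAt]
        exact state_spinProduct_nonneg_field J β δ hβ.le hδ.le hJ _
      calc (#Λ : ℝ) * state J β δ (spinAt 0) + 2 * (∑ x ∈ Λ, plusField J Λ x) / δ
          ≤ #Λ * (ε / (8 * Cd)) + 2 * (ε * δ / (16 * Cd) * #Λ) / δ := by
            gcongr
        _ = #Λ * (ε / (4 * Cd)) := by field_simp; ring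
        _ ≤ Cd * #(box d R) * (ε / (4 * Cd)) := by
            gcongr
    linarith [h1, h2, h3, h4, h5, h6]
  ---------------------------------------------------------------- conclusion
  obtain ⟨N₁, hN₁⟩ := hlow
  refine ⟨max N₁ (max (2 * R' + 1) (M₁ + 1)), fun M _ hM => ?_⟩
  have hMN₁ : N₁ ≤ M := le_of_max_le_left hM
  have hMR : 2 * R' + 1 ≤ M := le_trans (le_max_left _ _) (le_of_max_le_right hM)
  have hMM₁ : M₁ + 1 ≤ M := le_trans (le_max_right _ _) (le_of_max_le_right hM)
  have hGlow := hN₁ M hMN₁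
  -- `G_M ≤ P_M(a)` for every `a ∈ Λ_R`
  have hGP : ∀ a ∈ box d R,
      torusExpect (torusCoupling J M) β 0 (fun σ => spinAt 0 σ * spinAt (Torus.proj M z) σ) ≤ P M a := by
    intro a ha
    rw [torusPair_eq_torusExpect_image hJt hMR hz (hbox ha) (hmemz a ha)]
    exact torusExpect_le_plusBox_periodic hβ.le hJ hJt hJs hJsym hMR
      (Finset.insert_subset_iff.2 ⟨hbox ha, Finset.singleton_subset_iff.2 (hmemz a ha)⟩)
  have hGavg : (#(box d R) : ℝ) * torusExpect (torusCoupling J M) β 0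
      (fun σ => spinAt 0 σ * spinAt (Torus.proj M z) σ) ≤ ∑ a ∈ box d R, P M a := by
    rw [← nsmul_eq_mul, ← Finset.sum_const]
    exact Finset.sum_le_sum hGP
  -- the average at `M` is close to the limit average
  have hclose : ∑ a ∈ box d R, P M a ≤ ∑ a ∈ box d R, Pinf a + ε / 4 * #(box d R) := by
    obtain ⟨M', rfl⟩ : ∃ M', M = M' + 1 := ⟨M - 1, by omega⟩
    have := hM₁ M' (by omega)
    rw [Real.dist_eq] at this
    linarith [(abs_lt.1 this).2]
  have hup : (#(box d R) : ℝ) * torusExpect (torusCoupling J M) β 0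
      (fun σ => spinAt 0 σ * spinAt (Torus.proj M z) σ) ≤ #(box d R) * (S + ε / 2) := by
    have := hGavg.trans (hclose.trans (add_le_add hsumPinf le_rfl))
    have e : (#(box d R) : ℝ) * S + Cd * #(box d R) * (ε / (4 * Cd)) + ε / 4 * #(box d R) =
        #(box d R) * (S + ε / 2) := by field_simp; ring
    linarith [this, e.le]
  have hup' := le_of_mul_le_mul_left hup hcard
  rw [abs_le]
  constructor <;> linarith

end TorusLimit

end LongRangeIsing

end Literature.Barriers.CriticalPhenomena
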